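import Summits.Parity.BatemanHorn.Theorems.AlmostPrimeZerosSystemLSDRealSegmentRealForm
import HarnessLib

/-!
# Route `AlmostPrimeZeros`, crux `SystemLSDRealSegment` (stmt-Parity-11292), line
# `beta-thinned-root-kernel`: the kernel law for ONE polynomial as a level-of-distribution statement

Registered helper `betaKernelLaw_one_iff_levelLaw`.  For a single Bateman–Horn polynomial `f`
(`k = 1`) of degree `g = natDegree f₀ ≥ 1` and real `y > 1`, the open kernel law `BetaKernelLaw 1 f y`
— in real form (`betaKernelLaw_iff_tendsto_real`) `K_x/(x (log x)^{y−1}) → P·(g^{y−1} − 1)/Γ(y)`,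
`P = λ_f(y)` real — is EQUIVALENT to
`K_x − x·Σ_{x < d ≤ x^g} b(d) = o(x (log x)^{y−1})`, `b = bCoeff f y`,
because the CRT model `x·Σ_{x < d ≤ x^g} b(d)` of the kernel has, after the same normalisation, the
limit `P·(g^{y−1} − 1)/Γ(y)` by the landed Levin–Faĭnleĭb asymptotics `exists_eulerFactor_ofReal`
(`Σ_{d ≤ D} b(d) ∼ P (log D)^{y−1}/Γ(y)`, read at `D = x^g` and `D = x`).

Contents (all elementary real analysis):
* `levelLaw_tendsto_div_iff` — `M/N → c ⇒ (K/N → c ↔ (K − M)/N → 0)`;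
* `levelLaw_window_tendsto` — `Σ_{d≤D} b(d)/(log D)^κ → c ⇒ x·Σ_{x<d≤x^g} b(d)/(x (log x)^κ) → c (g^κ − 1)`;
* `betaKernelLaw_one_iff_levelLaw` — the registered statement.
-/

open Filter Finset Polynomial
open scoped BigOperators Topology

namespace Summit.Parity.BatemanHorn.Cruxes.SystemLSDRealSegment.BetaThinnedRootKernel

open Literature.NumberTheory.Sieve

noncomputable section

/-- Elementary: if `M_x/N_x → c`, then `K_x/N_x → c ↔ (K_x − M_x)/N_x → 0`. [folklore] -/
theorem levelLaw_tendsto_div_iff {K M N : ℕ → ℝ} {c : ℝ}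
    (hM : Tendsto (fun x => M x / N x) atTop (𝓝 c)) :
    Tendsto (fun x => K x / N x) atTop (𝓝 c) ↔ Tendsto (fun x => (K x - M x) / N x) atTop (𝓝 0) := by
  constructor
  · intro hK
    have h := hK.sub hM
    rw [sub_self] at h
    exact h.congr fun x => (sub_div _ _ _).symm
  · intro hD
    have h := hD.add hM
    rw [zero_add] at h
    refine h.congr fun x => ?_
    rw [← add_div, sub_add_cancel]

/-- Elementary: if `Σ_{1≤d≤D} b(d)/(log D)^κ → c`, then for `g ≥ 1` the window `x < d ≤ x^g` satisfies
`(x·Σ_{x<d≤x^g} b(d))/(x (log x)^κ) → c (g^κ − 1)` (`log (x^g) = g log x`). [folklore] -/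
theorem levelLaw_window_tendsto (b : ℕ → ℝ) {g : ℕ} (hg : 1 ≤ g) {κ c : ℝ}
    (hG : Tendsto (fun D : ℕ => (∑ d ∈ Icc 1 D, b d) / Real.log D ^ κ) atTop (𝓝 c)) :
    Tendsto (fun x : ℕ => ((x : ℝ) * ∑ d ∈ Ioc x (x ^ g), b d) / ((x : ℝ) * Real.log x ^ κ)) atTop
      (𝓝 (c * ((g : ℝ) ^ κ - 1))) := by
  have hg0 : g ≠ 0 := by omega
  have hgpos : (0 : ℝ) < g := Nat.cast_pos.mpr (by omega)
  have hgκ : (g : ℝ) ^ κ ≠ 0 := (Real.rpow_pos_of_pos hgpos κ).ne'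
  have hlim : Tendsto (fun x : ℕ => (g : ℝ) ^ κ *
      ((∑ d ∈ Icc 1 (x ^ g), b d) / Real.log (((x ^ g : ℕ) : ℝ)) ^ κ) -
        (∑ d ∈ Icc 1 x, b d) / Real.log x ^ κ) atTop (𝓝 ((g : ℝ) ^ κ * c - c)) :=
    ((hG.comp (tendsto_pow_atTop hg0)).const_mul ((g : ℝ) ^ κ)).sub hG
  rw [show c * ((g : ℝ) ^ κ - 1) = (g : ℝ) ^ κ * c - c by ring]
  refine hlim.congr' ?_
  filter_upwards [eventually_ge_atTop 2] with x hx
  have hx0 : (x : ℝ) ≠ 0 := Nat.cast_ne_zero.mpr (by omega)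
  have hlogx : 0 < Real.log x := Real.log_pos (Nat.one_lt_cast.mpr (by omega))
  have hsplit : ∑ d ∈ Ioc x (x ^ g), b d = ∑ d ∈ Icc 1 (x ^ g), b d - ∑ d ∈ Icc 1 x, b d := by
    rw [show (Icc 1 (x ^ g) : Finset ℕ) = Ioc 0 (x ^ g) from Finset.Icc_succ_left_eq_Ioc 0 _,
      show (Icc 1 x : Finset ℕ) = Ioc 0 x from Finset.Icc_succ_left_eq_Ioc 0 _,
      ← Finset.sum_Ioc_consecutive b (Nat.zero_le x) (Nat.le_self_pow hg0 x)]
    ring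
  rw [mul_div_mul_left _ _ hx0, Nat.cast_pow, Real.log_pow, Real.mul_rpow hgpos.le hlogx.le, hsplit,
    ← mul_div_assoc, mul_div_mul_left _ _ hgκ, sub_div]

/-- **betaKernelLaw_one_iff_levelLaw** (registered helper of the line `beta-thinned-root-kernel`): for ONE
Bateman–Horn polynomial `f` of degree `g = natDegree f₀` and real `y > 1`, the open kernel law
`BetaKernelLaw 1 f y` is equivalent to the level-of-distribution statement
`K_x − x·Σ_{x<d≤x^g} b(d) = o(x (log x)^{y−1})`, `K_x = kernelSum f y x`, `b = bCoeff f y`: the CRT model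
of the kernel carries the predicted constant `λ_f(y)(g^{y−1} − 1)/Γ(y)` by the Levin–Faĭnleĭb asymptotics
(`exists_eulerFactor_ofReal`) read at `D = x^g` and `D = x`, and the kernel law in real form is
`betaKernelLaw_iff_tendsto_real`. [folklore] -/
theorem betaKernelLaw_one_iff_levelLaw : ∀ (f : Fin 1 → ℤ[X]), IsBatemanHornSystem f → ∀ y : ℝ, 1 < y → (BetaKernelLaw 1 f y ↔ Tendsto (fun x : ℕ => (kernelSum f y x - (x : ℝ) * ∑ d ∈ Finset.Ioc x (x ^ (f 0).natDegree), bCoeff f y d) / ((x : ℝ) * Real.log x ^ (y - 1))) atTop (nhds 0)) := by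
  intro f hf y hy
  obtain ⟨P, hP, -, hG⟩ := exists_eulerFactor_ofReal hf hy.le
  have hg : 1 ≤ (f 0).natDegree := hf.natDegree_pos 0
  have hgpos : (0 : ℝ) < ((f 0).natDegree : ℝ) := Nat.cast_pos.mpr (by omega)
  simp only [Nat.cast_one, one_mul, sub_add_cancel] at hG
  have hM := levelLaw_window_tendsto (bCoeff f y) hg hG
  rw [betaKernelLaw_iff_tendsto_real hf hy.le, hP, Complex.ofReal_re]
  simp only [Nat.cast_one, one_mul, pow_one, Fin.prod_univ_one, sub_add_cancel]
  rw [show Real.exp ((y - 1) * Real.log ((f 0).natDegree : ℝ)) = ((f 0).natDegree : ℝ) ^ (y - 1) by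
    rw [Real.rpow_def_of_pos hgpos, mul_comm (Real.log _)]]
  rw [show P / Real.Gamma y * ((((f 0).natDegree : ℝ)) ^ (y - 1) - 1) =
      P * (((f 0).natDegree : ℝ) ^ (y - 1) * (Real.Gamma y)⁻¹ - (Real.Gamma y)⁻¹) by ring] at hM
  exact levelLaw_tendsto_div_iff hM

end

end Summit.Parity.BatemanHorn.Cruxes.SystemLSDRealSegment.BetaThinnedRootKernel
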